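import Mathlib
import HarnessLib
import HarnessLib.Audit
import Summits.Langlands.Statement
import Summits.Langlands.Langlands.Theses.RootDecomp1
import Literature.NumberTheory.GaloisRepresentations.HeckeDeterminant
import Summits.Langlands.Langlands.Theses.DeterminantTowerSplit

/-! BC3 birth skeleton for crux `DeterminantTowerAvatars` (DEPTH) of the child route DeterminantTowerSplit (lens-3 g16; refines RootDecomp1:AccessibleAvatars 29148).
POST-BIRTH form: concludes the ROUTE decl by name.
Stubs: stub_depthShimura, stub_depthMixed, stub_depthIrregular — each a genuine theorem-sized piece (population split along the catalogued barriers), none restates the crux or the summit (probes: probes/). `DeterminantTowerAvatars_of` is proved (case split); sorries ONLY inside `stub_*`. -/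

set_option linter.unusedVariables false
set_option linter.dupNamespace false

namespace Summit.Langlands.Langlands.Cruxes.DeterminantTowerAvatars.Birth

open scoped BigOperators Topology Manifold Classical MeasureTheory ProbabilityTheory Matrix InnerProductSpace ComplexConjugate ContinuousMap
open Filter Set Function TopologicalSpace MeasureTheory

open Summit.Langlands.Langlands.Theses.DeterminantTowerSplit (DeterminantTowerAvatars)

/-- DEPTH for REGULAR π over TOTALLY REAL or CM K (PRINT modulo typing): either from the known avatars (tree fact exists_galoisRep_of_regularAlgebraic, HLTT 2016 / Scholze 2015, after the L ↔ C twist) through the node's PROVED dictionary `DetTower.tower_of_framedRep` (integral model over 𝒪, reduction mod ℓ^m, GroupDeterminant.ofMonoidHom, open kernel), or directly from Scholze 2015 Cor 5.4.x (determinants valued in 𝕋(K,i,m)/I on H^i(X_K, ℤ/ℓ^m)) specialised at π's eigensystem. Inside Acc's known regime — DEPTH is the declared residual, this stub is its print floor. -/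
theorem stub_depthShimura :
    ∀ (K : Type) [Field K] [NumberField K] (n : ℕ) (hcpt : Literature.NumberTheory.Automorphic.isCompact_glFiniteIntegralLevel n K), 0 < n → Module.finrank (NumberField.maximalRealSubfield K) K ≤ 2 → ∀ (π : Literature.NumberTheory.Automorphic.CuspidalAutomorphicRepData n K hcpt), π.1.IsLAlgebraic → (NumberField.IsTotallyReal K ∨ NumberField.IsCMField K) → (∃ T : Literature.NumberTheory.Automorphic.InfinityType K n, π.1.HasInfinityType T ∧ T.IsRegular) → ∀ (ℓ : ℕ) [Fact ℓ.Prime] (ι : PadicAlgCl ℓ ≃+* ℂ), ∃ S : Finset (IsDedekindDomain.HeightOneSpectrum (NumberField.RingOfIntegers K)), ∀ m : ℕ, 0 < m → ∃ D : Literature.NumberTheory.GaloisRepresentations.GaloisDeterminant K (↥(Valued.v : Valuation (PadicAlgCl ℓ) NNReal).valuationSubring ⧸ Ideal.span {((ℓ ^ m : ℕ) : ↥(Valued.v : Valuation (PadicAlgCl ℓ) NNReal).valuationSubring)}) n, IsLocallyConstant (fun g : Field.absoluteGaloisGroup K => D.charpoly (MonoidAlgebra.of _ _ g)) ∧ ∀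 v ∉ S, D.IsUnramifiedAt v ∧ ∀ α : Multiset ℂ, π.1.HasSatakeParamAt v α → ∀ P : Polynomial ↥(Valued.v : Valuation (PadicAlgCl ℓ) NNReal).valuationSubring, P.map (Valued.v : Valuation (PadicAlgCl ℓ) NNReal).valuationSubring.subtype = Literature.NumberTheory.Automorphic.arithFrobPolyOfSatake ι v.residueCard 1 α → D.HasFrobCharpolyAt v (P.map (Ideal.Quotient.mk (Ideal.span {((ℓ ^ m : ℕ) : ↥(Valued.v : Valuation (PadicAlgCl ℓ) NNReal).valuationSubring)}))) := by
  sorry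

/-- DEPTH for REGULAR π over MIXED-signature K ([K:K⁺] = 2, K not CM, e.g. ℚ(2^{1/4})) (OPEN; inside ShimuraVarietyRealizationBarrier: Goldring §4.4.3 «no known way to relate π to the cohomology of an algebraic variety»): produce, depth by depth, an 𝒪/ℓ^m determinant with the Satake polynomials mod ℓ^m — the address for non-Shimura engines (torsion classes of X_K and their Galois determinants à la Calegari–Geraghty/Scholze would need a new period-free construction). -/
theorem stub_depthMixed :
    ∀ (K : Type) [Field K] [NumberField K] (n : ℕ) (hcpt : Literature.NumberTheory.Automorphic.isCompact_glFiniteIntegralLevel n K), 0 < n → Module.finrank (NumberField.maximalRealSubfield K) K ≤ 2 → ∀ (π : Literature.NumberTheory.Automorphic.CuspidalAutomorphicRepData n K hcpt), π.1.IsLAlgebraic → ¬ (NumberField.IsTotallyReal K ∨ NumberField.IsCMField K) → (∃ T : Literature.NumberTheory.Automorphic.InfinityType K n, π.1.HasInfinityType T ∧ T.IsRegular) → ∀ (ℓ : ℕ) [Fact ℓ.Prime] (ι : PadicAlgCl ℓ ≃+* ℂ), ∃ S : Finset (IsDedekindDomain.HeightOneSpectrum (NumberField.RingOfIntegers K)),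 ∀ m : ℕ, 0 < m → ∃ D : Literature.NumberTheory.GaloisRepresentations.GaloisDeterminant K (↥(Valued.v : Valuation (PadicAlgCl ℓ) NNReal).valuationSubring ⧸ Ideal.span {((ℓ ^ m : ℕ) : ↥(Valued.v : Valuation (PadicAlgCl ℓ) NNReal).valuationSubring)}) n, IsLocallyConstant (fun g : Field.absoluteGaloisGroup K => D.charpoly (MonoidAlgebra.of _ _ g)) ∧ ∀ v ∉ S, D.IsUnramifiedAt v ∧ ∀ α : Multiset ℂ, π.1.HasSatakeParamAt v α → ∀ P : Polynomial ↥(Valued.v : Valuation (PadicAlgCl ℓ) NNReal).valuationSubring, P.map (Valued.v : Valuation (PadicAlgCl ℓ) NNReal).valuationSubring.subtype = Literature.NumberTheory.Automorphic.arithFrobPolyOfSatake ι v.residueCard 1 α → D.HasFrobCharpolyAt v (P.map (Ideal.Quotient.mk (Ideal.span {((ℓ ^ m : ℕ) : ↥(Valued.v : Valuation (PadicAlgCl ℓ) NNReal).valuationSubring)}))) := by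
  sorry

/-- DEPTH for IRREGULAR π (OPEN; inside NonRegularWeightBarrier): no p-adic avatar of π is known; depth-one (m = 1) alone would give the residual avatar ρ̄_π. Candidate inputs: congruences of π to cohomological forms modulo ℓ^m produced on the automorphic side (theta correspondences, weight-shifting à la Goldring–Koskivirta for coherent cohomology where available), each depth separately. -/
theorem stub_depthIrregular :
    ∀ (K : Type) [Field K] [NumberField K] (n : ℕ) (hcpt : Literature.NumberTheory.Automorphic.isCompact_glFiniteIntegralLevel n K), 0 < n → Module.finrank (NumberField.maximalRealSubfield K) K ≤ 2 → ∀ (π : Literature.NumberTheory.Automorphic.CuspidalAutomorphicRepData n K hcpt), π.1.IsLAlgebraic → ¬ (∃ T : Literature.NumberTheory.Automorphic.InfinityType K n, π.1.HasInfinityType T ∧ T.IsRegular) → ∀ (ℓ : ℕ) [Fact ℓ.Prime] (ι : PadicAlgCl ℓ ≃+* ℂ), ∃ S : Finset (IsDedekindDomain.HeightOneSpectrum (NumberField.RingOfIntegers K)), ∀ m : ℕ, 0 < m → ∃ D : Literature.NumberTheory.GaloisRepresentations.GaloisDeterminant K (↥(Valued.v : Valuation (PadicAlgCl ℓ) NNReal).valuationSubring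 ⧸ Ideal.span {((ℓ ^ m : ℕ) : ↥(Valued.v : Valuation (PadicAlgCl ℓ) NNReal).valuationSubring)}) n, IsLocallyConstant (fun g : Field.absoluteGaloisGroup K => D.charpoly (MonoidAlgebra.of _ _ g)) ∧ ∀ v ∉ S, D.IsUnramifiedAt v ∧ ∀ α : Multiset ℂ, π.1.HasSatakeParamAt v α → ∀ P : Polynomial ↥(Valued.v : Valuation (PadicAlgCl ℓ) NNReal).valuationSubring, P.map (Valued.v : Valuation (PadicAlgCl ℓ) NNReal).valuationSubring.subtype = Literature.NumberTheory.Automorphic.arithFrobPolyOfSatake ι v.residueCard 1 α → D.HasFrobCharpolyAt v (P.map (Ideal.Quotient.mk (Ideal.span {((ℓ ^ m : ℕ) : ↥(Valued.v : Valuation (PadicAlgCl ℓ) NNReal).valuationSubring)}))) := by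
  sorry

/-- the composition: the stubs imply the crux (population case split). -/
theorem DeterminantTowerAvatars_of :
    (∀ (K : Type) [Field K] [NumberField K] (n : ℕ) (hcpt : Literature.NumberTheory.Automorphic.isCompact_glFiniteIntegralLevel n K), 0 < n → Module.finrank (NumberField.maximalRealSubfield K) K ≤ 2 → ∀ (π : Literature.NumberTheory.Automorphic.CuspidalAutomorphicRepData n K hcpt), π.1.IsLAlgebraic → (NumberField.IsTotallyReal K ∨ NumberField.IsCMField K) → (∃ T : Literature.NumberTheory.Automorphic.InfinityType K n, π.1.HasInfinityType T ∧ T.IsRegular) → ∀ (ℓ : ℕ) [Fact ℓ.Prime] (ι : PadicAlgCl ℓ ≃+* ℂ), ∃ S : Finset (IsDedekindDomain.HeightOneSpectrum (NumberField.RingOfIntegers K)), ∀ m : ℕ, 0 < m → ∃ D : Literature.NumberTheory.GaloisRepresentations.GaloisDeterminant K (↥(Valued.v : Valuation (PadicAlgCl ℓ) NNReal).valuationSubring ⧸ Ideal.span {((ℓ ^ m : ℕ) : ↥(Valued.v : Valuation (PadicAlgCl ℓ) NNReal).valuationSubring)}) n, IsLocallyConstant (fun g : Field.absoluteGaloisGroup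 K => D.charpoly (MonoidAlgebra.of _ _ g)) ∧ ∀ v ∉ S, D.IsUnramifiedAt v ∧ ∀ α : Multiset ℂ, π.1.HasSatakeParamAt v α → ∀ P : Polynomial ↥(Valued.v : Valuation (PadicAlgCl ℓ) NNReal).valuationSubring, P.map (Valued.v : Valuation (PadicAlgCl ℓ) NNReal).valuationSubring.subtype = Literature.NumberTheory.Automorphic.arithFrobPolyOfSatake ι v.residueCard 1 α → D.HasFrobCharpolyAt v (P.map (Ideal.Quotient.mk (Ideal.span {((ℓ ^ m : ℕ) : ↥(Valued.v : Valuation (PadicAlgCl ℓ) NNReal).valuationSubring)})))) →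
    (∀ (K : Type) [Field K] [NumberField K] (n : ℕ) (hcpt : Literature.NumberTheory.Automorphic.isCompact_glFiniteIntegralLevel n K), 0 < n → Module.finrank (NumberField.maximalRealSubfield K) K ≤ 2 → ∀ (π : Literature.NumberTheory.Automorphic.CuspidalAutomorphicRepData n K hcpt), π.1.IsLAlgebraic → ¬ (NumberField.IsTotallyReal K ∨ NumberField.IsCMField K) → (∃ T : Literature.NumberTheory.Automorphic.InfinityType K n, π.1.HasInfinityType T ∧ T.IsRegular) → ∀ (ℓ : ℕ) [Fact ℓ.Prime] (ι : PadicAlgCl ℓ ≃+* ℂ), ∃ S : Finset (IsDedekindDomain.HeightOneSpectrum (NumberField.RingOfIntegers K)), ∀ m : ℕ, 0 < m → ∃ D : Literature.NumberTheory.GaloisRepresentations.GaloisDeterminant K (↥(Valued.v : Valuation (PadicAlgCl ℓ) NNReal).valuationSubring ⧸ Ideal.span {((ℓ ^ m : ℕ) : ↥(Valued.v : Valuation (PadicAlgCl ℓ) NNReal).valuationSubring)}) n, IsLocallyConstant (fun g : Field.absoluteGaloisGroup K => D.charpoly (MonoidAlgebra.of _ _ g)) ∧ ∀ v ∉ S,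 D.IsUnramifiedAt v ∧ ∀ α : Multiset ℂ, π.1.HasSatakeParamAt v α → ∀ P : Polynomial ↥(Valued.v : Valuation (PadicAlgCl ℓ) NNReal).valuationSubring, P.map (Valued.v : Valuation (PadicAlgCl ℓ) NNReal).valuationSubring.subtype = Literature.NumberTheory.Automorphic.arithFrobPolyOfSatake ι v.residueCard 1 α → D.HasFrobCharpolyAt v (P.map (Ideal.Quotient.mk (Ideal.span {((ℓ ^ m : ℕ) : ↥(Valued.v : Valuation (PadicAlgCl ℓ) NNReal).valuationSubring)})))) →
    (∀ (K : Type) [Field K] [NumberField K] (n : ℕ) (hcpt : Literature.NumberTheory.Automorphic.isCompact_glFiniteIntegralLevel n K), 0 < n → Module.finrank (NumberField.maximalRealSubfield K) K ≤ 2 → ∀ (π : Literature.NumberTheory.Automorphic.CuspidalAutomorphicRepData n K hcpt), π.1.IsLAlgebraic → ¬ (∃ T : Literature.NumberTheory.Automorphic.InfinityType K n, π.1.HasInfinityType T ∧ T.IsRegular) → ∀ (ℓ : ℕ) [Fact ℓ.Prime] (ι : PadicAlgCl ℓ ≃+* ℂ), ∃ S : Finset (IsDedekindDomain.HeightOneSpectrum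 (NumberField.RingOfIntegers K)), ∀ m : ℕ, 0 < m → ∃ D : Literature.NumberTheory.GaloisRepresentations.GaloisDeterminant K (↥(Valued.v : Valuation (PadicAlgCl ℓ) NNReal).valuationSubring ⧸ Ideal.span {((ℓ ^ m : ℕ) : ↥(Valued.v : Valuation (PadicAlgCl ℓ) NNReal).valuationSubring)}) n, IsLocallyConstant (fun g : Field.absoluteGaloisGroup K => D.charpoly (MonoidAlgebra.of _ _ g)) ∧ ∀ v ∉ S, D.IsUnramifiedAt v ∧ ∀ α : Multiset ℂ, π.1.HasSatakeParamAt v α → ∀ P : Polynomial ↥(Valued.v : Valuation (PadicAlgCl ℓ) NNReal).valuationSubring, P.map (Valued.v : Valuation (PadicAlgCl ℓ) NNReal).valuationSubring.subtype = Literature.NumberTheory.Automorphic.arithFrobPolyOfSatake ι v.residueCard 1 α → D.HasFrobCharpolyAt v (P.map (Ideal.Quotient.mk (Ideal.span {((ℓ ^ m : ℕ) : ↥(Valued.v : Valuation (PadicAlgCl ℓ) NNReal).valuationSubring)})))) →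
    DeterminantTowerAvatars := by
  intro h1 h2 h3 K _ _ n hcpt hn hK π hπ
  by_cases hreg : (∃ T : Literature.NumberTheory.Automorphic.InfinityType K n, π.1.HasInfinityType T ∧ T.IsRegular)
  · by_cases hsh : (NumberField.IsTotallyReal K ∨ NumberField.IsCMField K)
    · exact h1 K n hcpt hn hK π hπ hsh hreg
    · exact h2 K n hcpt hn hK π hπ hsh hreg
  · exact h3 K n hcpt hn hK π hπ hreg

theorem DeterminantTowerAvatars_holds : DeterminantTowerAvatars := DeterminantTowerAvatars_of stub_depthShimura stub_depthMixed stub_depthIrregular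

theorem DeterminantTowerAvatars_proof : Summit.Langlands.Langlands.Theses.DeterminantTowerSplit.DeterminantTowerAvatars := DeterminantTowerAvatars_holds

end Summit.Langlands.Langlands.Cruxes.DeterminantTowerAvatars.Birth
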